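import Summits.Ventures.AbcSig.Rows.XTemplateBC6
import Summits.Ventures.AbcSig.Rows.XTemplateBC
import Summits.Ventures.AbcSig.Levels.N441
import Summits.Ventures.AbcSig.Levels.N882
import Summits.Ventures.AbcSig.Levels.N441Q2

/-!
# Venture AbcSig — ROW `Xn64Yn21Z2`: `xⁿ + 64 yⁿ = 21 z²` (FAMILY C1b, `α = 6`; GENERATED by p-lean gen3/leanrow_c1b6.py)

Q-VARIANT (p-lean g6 `gen6/spatch2.py`): same statement shape as `xrow_Xn64Yn21Z2` plus ONE more named CITED hypothesis `(hQ : M.Q2Package)` (`Recipes/Q2Package.lean`: the cell's q = 2 rule at ODD level, allowed traces {±1, ±3}), in exchange for which the residual pair(s) 441.2 @ 11, 441.2 @ 13, 441.3 @ 11, 441.3 @ 13 — closed in the row of record only by the sieve prime q = 2 (citation-backing audit plean/g5/THETAVERIFY-RECORD.md Part C, class Q2-RULE), previously opaque CITED hypotheses `hX_…` — are discharged IN THE KERNEL (`Levels/N441Q2.lean`: the orbit's eigenvalues including `c₂`, mod-n TreeN certificate against `q2Allowed`) under the COMPUTED hypothesis `hQ2_… : ∀ f, Matches f orbit → Matches f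 q2`.
HONEST FRAMING. A row of a COMPUTATION cell (`pub-abcsig`); a CONDITIONAL theorem, no claim on ABC or any summit.
Hypotheses: `BS04Package` (CITED: [BS04] Lemma 3.3 + (3.1) + Lemma 4.2), `DataComplete` at the levels
441 = 21² (`y` odd, case (v₆)) and 882 = 2·21² (`y` even, case (v₇)) (COMPUTED, certified level files), `Refines…` of
kernel module certificates (COMPUTED) if any, and the listed per-orbit exclusions `hX_…` (CITED; the row of record's R3/R5
name the module / printed argument per orbit: M4 Kraus certificates, M6c, [BS04, Prop. 4.4 / 4.6]). Everything else is
kernel-checked (`Rows/XTemplateBC6.lean`, `Rows/XTemplateBC.lean`, `Levels/N….lean`).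
Exponent range: prime `n ≥ 11`; `x·y ≠ ±1`.
Row of record: `census/rows/C1b/C1b-C21-a6.md` (sha16 `4706060055378d09`; R8-signed by referee ref-g20, 2026-08-22T23:18Z); p1's statement of record: the conjunct `Rows.C1bCell 21 (fun _ α => α = 6) 11 ∅` of `Rows.C1bExtSigned` (`Rows/StatementsC1b.lean`). Level 441 = 21² generated on the hub from the census level file (engine-1 Sturm file). Residual exponents of OUR kernel sieve that the row closes by a module (M4 Kraus — family-specific —, M6 / M6c, [BS04, Prop. 4.4 / 4.6]) enter as the named hypotheses `hX_… : n ∈ [...] → M.Excludes …` (CITED), as do rational orbits not eliminable by the sieve (all n).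
-/

namespace Summit.Ventures.AbcSig

/-- Row `Xn64Yn21Z2`: no primitive solution of `xⁿ + 64 yⁿ = 21 z²` with `x·y ≠ ±1` for prime `n ≥ 11`,
conditional on the named hypotheses. -/
theorem xrow_Xn64Yn21Z2Q (M : NewformModel) (hP : M.BS04Package) (hQ : M.Q2Package)
    (hD441 : M.DataComplete 441 level441Orbits) (hD882 : M.DataComplete 882 level882Orbits)
    (n : ℕ) (hn : n.Prime) (hmin : 11 ≤ n)
    (hX_orbit_441_1 : M.Excludes 441 orbit_441_1
      (famBC 6 21 n (fun _ b => ¬ 2 ∣ b)))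
    (hQ2_orbit_441_2 : ∀ f : M.Form 441, M.Matches f orbit_441_2 → M.Matches f q2_441_2)
    (hQ2_orbit_441_3 : ∀ f : M.Form 441, M.Matches f orbit_441_3 → M.Matches f q2_441_3)
    (hX_orbit_441_4 : M.Excludes 441 orbit_441_4
      (famBC 6 21 n (fun _ b => ¬ 2 ∣ b)))
    (hX_orbit_882_1 : M.Excludes 882 orbit_882_1
      (famBC 6 21 n (fun _ b => 2 ∣ b)))
    (hX_orbit_882_6 : M.Excludes 882 orbit_882_6
      (famBC 6 21 n (fun _ b => 2 ∣ b)))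
    (hX_orbit_882_8 : M.Excludes 882 orbit_882_8
      (famBC 6 21 n (fun _ b => 2 ∣ b)))
    (hX_orbit_882_12 : M.Excludes 882 orbit_882_12
      (famBC 6 21 n (fun _ b => 2 ∣ b)))
    (x y z : ℤ) (hxy1 : x * y ≠ 1) (hxy2 : x * y ≠ -1) : ¬ IsPrimitiveSolution 1 (2 ^ 6) 21 n x y z := by
  have h7 : 7 ≤ n := by omega
  have hsq : Squarefree (21 : ℕ) := by
    have h : (21 : ℕ) = 3 * 7 := by norm_num
    rw [h, Nat.squarefree_mul (by norm_num)]
    exact ⟨(Nat.prime_iff.mp (by norm_num)).squarefree, (Nat.prime_iff.mp (by norm_num)).squarefree⟩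
  have hnC : ¬ n ∣ 21 := by
    intro h
    have h' : n ∣ 3 * 7 := by simpa using h
    rcases (Nat.Prime.dvd_mul hn).mp h' with h1 | h1
    · rcases (Nat.dvd_prime (by norm_num : Nat.Prime 3)).mp h1 with h2 | h2 <;> omega
    · rcases (Nat.dvd_prime (by norm_num : Nat.Prime 7)).mp h1 with h2 | h2 <;> omega
  by_cases hy : 2 ∣ y
  · exact xbranchBC_v7 6 21 hsq (by decide) M hP hD882 n hn h7 hnC (by omega)
      (level882_sieve n hn h7 (fun o => M.Excludes 882 o
      (famBC 6 21 n (fun _ b => 2 ∣ b)) ∨ M.ExcludesStd 882 o n) (Or.inl hX_orbit_882_1) (fun hmem => by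
      obtain rfl : n = 7 := by simpa using hmem
      omega) (fun hmem => by
      obtain rfl : n = 7 := by simpa using hmem
      omega) (fun hmem => by
      obtain rfl : n = 7 := by simpa using hmem
      omega) (fun hmem => by
      obtain rfl : n = 7 := by simpa using hmem
      omega) (Or.inl hX_orbit_882_6) (fun hmem => by
      obtain rfl : n = 7 := by simpa using hmem
      omega) (Or.inl hX_orbit_882_8) (fun hmem => by
      obtain rfl : n = 7 := by simpa using hmem
      omega) (fun hmem => by
      obtain rfl : n = 7 := by simpa using hmem
      omega) (fun hmem => by
      obtain rfl : n = 7 := by simpa using hmem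
      omega) (Or.inl hX_orbit_882_12) (fun hmem => by
      obtain rfl : n = 7 := by simpa using hmem
      omega) (fun hmem => by
      obtain rfl : n = 7 := by simpa using hmem
      omega) (fun hmem => by
      obtain rfl : n = 7 := by simpa using hmem
      omega))
      x y z hy hxy1 hxy2
  · exact xbranchBC_v6 21 hsq (by decide) M hP hD441 n hn h7 hnC
      (level441_sieve n hn h7 (fun o => M.Excludes 441 o
      (famBC 6 21 n (fun _ b => ¬ 2 ∣ b)) ∨ M.ExcludesStd 441 o n) (Or.inl hX_orbit_441_1) (fun hmem => by
      rcases (by simpa using hmem : n = 7 ∨ n = 11 ∨ n = 13) with rfl | rfl | rfl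
      · omega
      · exact Or.inr (orbit_441_2_exclStdQ2_11 M hQ hQ2_orbit_441_2)
      · exact Or.inr (orbit_441_2_exclStdQ2_13 M hQ hQ2_orbit_441_2)) (fun hmem => by
      rcases (by simpa using hmem : n = 7 ∨ n = 11 ∨ n = 13) with rfl | rfl | rfl
      · omega
      · exact Or.inr (orbit_441_3_exclStdQ2_11 M hQ hQ2_orbit_441_3)
      · exact Or.inr (orbit_441_3_exclStdQ2_13 M hQ hQ2_orbit_441_3)) (Or.inl hX_orbit_441_4) (fun hmem => by
      obtain rfl : n = 7 := by simpa using hmem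
      omega) (fun hmem => by
      obtain rfl : n = 7 := by simpa using hmem
      omega) (fun hmem => by
      obtain rfl : n = 7 := by simpa using hmem
      omega) (fun hmem => by
      obtain rfl : n = 7 := by simpa using hmem
      omega) (fun hmem => by
      obtain rfl : n = 7 := by simpa using hmem
      omega))
      x y z hy hxy1 hxy2

end Summit.Ventures.AbcSig
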